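import Literature.Computability.AlgebraicComplexity.IK2020ContentSliceTransport
import HarnessLib

/-!
# The rank of a product of Young symmetrizers: `c^λ_{μ¹…μ^d}` as a trace on `[λ]`

Topic `Literature/Computability/AlgebraicComplexity` (val-lit cell, board U1 = `IK2020_prop_10_1`,
a brick of part **P2** of `HOME/bip/NOTE-t08g3-IK2020Prop101-route.md`). Theorems only: no
definitions, no named facts.

Ikenmeyer–Kandasamy 2020 §3 (TeX L353–357) define the multi-Littlewood–Richardson coefficient
`c^λ_{μ¹,…,μ^d}` as the multiplicity of `{λ}` in `{μ¹} ⊗ ⋯ ⊗ {μ^d}`; the tree renders it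
(`IK2020.multiLRCoeff`) as the dimension of the highest-weight space of weight `λ` of
`c_{μ•} · V^{⊗n}`, `c_{μ•} = c_{μ¹} ⋯ c_{μ^d}` the product of the blockwise Young symmetrizers
(`IK2020.multiYoungSymmetrizer`), `n = n₁ + ⋯ + n_d`, `V = k^N`. This file proves the
symmetric-group reading of that number (Fulton–Harris §4.3, (4.41)–(4.43) and Ex. 4.44: the
Littlewood–Richardson number is a restriction/induction multiplicity between `𝔖_n` and the Young
subgroup `𝔖_{n₁} × ⋯ × 𝔖_{n_d}`), in the trace form that the rank formula for Young symmetrizers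
gives directly:

* §1 `mul_finrank_range_asAlgebraHom_eq_sum`: for a quasi-idempotent `a² = C a`, `C ≠ 0`, of the
  group algebra of a finite group acting on a finite-dimensional representation `M`,
  `C · dim (a · M) = ∑_g a(g) χ_M(g)` (Fulton–Harris §2.4, proof of Prop. 2.30 / Lemma 4.26);
* §2 `range_asAlgebraHom_inf_eq_map_of_mul_self`: `a · M ∩ X = a · X` for a stable subspace `X`
  (t08's `range_youngSymmetrizer_inf_eq_map` for general quasi-idempotents);
* §3 `IK2020.multiYoungSymmetrizer_mul_self`: `c_{μ•}² = (∏_i n_{μ^i}) c_{μ•}` — the blockwise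
  symmetrizers commute (`IK2020.commute_blockPermHom`) and `c_μ² = n_μ c_μ` (`youngSymmetrizer_sq`);
* §4 `IK2020.multiLRCoeff_eq_finrank_range`: `c^λ_{μ•} = dim (c_{μ•} · HW_λ((k^N)^{⊗n}))`, the
  highest-weight space of `multiWeylRep` transported along the coordinate isomorphism `wordCoord`
  (as in `IK2020ContentSliceTransport.lean`) and §2;
* §5 `IK2020.prod_mul_multiLRCoeff_eq_sum`: **`(∏_i n_{μ^i}) · c^λ_{μ•} = ∑_{g ∈ 𝔖_n} c_{μ•}(g) χ^λ(g)`**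
  for `ℓ(λ) ≤ N` (§1 + §3 + §4 + `character_hwPermRep`).

What remains of P2 after this file (for the record): per-block conjugation averaging
(`⇒ c^λ_{μ•} = ⟨Res_Y χ^λ, ⊠_i χ^{μ^i}⟩_Y`, `Y = ∏ 𝔖_{n_i}`), class-function completeness on `Y`,
the `K_γ`-average with `card_mul_finrank_wreathHW` per block, and the `Fin (dD) ≃ Fin (∑ n_i)`
bookkeeping of `IK2020.bCoeff`.

Honest framing: finite-group linear algebra; nothing here bears on VP versus VNP, which is NOT
proved.

## References

* [FultonHarrisGTM129] W. Fulton, J. Harris, *Representation Theory*, GTM 129: §2.4 (2.32),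
  Lemma 4.26, §4.3 (4.41)–(4.43), Ex. 4.44, §6.1 Lemma 6.22.
* [IkenmeyerKandasamy2019] C. Ikenmeyer, U. Kandasamy, arXiv:1911.03990, §3 (multi-LR
  coefficients), §10.

## Tree

`IK2020.blockPermHom`, `IK2020.multiYoungSymmetrizer`, `IK2020.multiWeylModule`,
`IK2020.multiWeylRep`, `IK2020.multiLRCoeff` (`IK20HighestWeightVectors`); `hwPermRep`,
`character_hwPermRep` (`WordHighestWeightSpecht`); `youngSymmetrizer_sq`,
`coeff_sq_youngSymmetrizer_ne_zero`; `wordCoord`, `wordCoord_glTensorRep`,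
`wordCoord_asAlgebraHom_permTensorRep` (t08, `YoungWreathSliceCharacter` §7), `highestWeightSpace`,
`hwMultiplicity`, `wordPerm_mem_highestWeightSpace`.
-/

noncomputable section

open scoped BigOperators

namespace Literature.Computability.AlgebraicComplexity

open _root_.Literature.NumberTheory.DiophantineGeometry

/-! ### §1 The rank of a quasi-idempotent of the group algebra -/

section Rank

variable {k : Type*} [Field k] {G : Type*} [Group G] {M : Type*} [AddCommGroup M] [Module k M]

/-- The trace of a group-algebra element on a finite-dimensional representation:
`tr ρ(a) = ∑_g a(g) χ_ρ(g)` (Fulton–Harris §2.4, proof of Prop. 2.30; the `𝔖_d` case is a private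
lemma of `IK2020OrbitClosureInvariantBound.lean`). [cite: FultonHarrisGTM129, §2.4 (2.32)] -/
theorem trace_asAlgebraHom_eq_sum [Fintype G] (ρ : Representation k G M) (a : MonoidAlgebra k G) :
    LinearMap.trace k M (ρ.asAlgebraHom a) = ∑ g, a.coeff g * ρ.character g := by
  rw [Representation.asAlgebraHom_def, MonoidAlgebra.lift_apply,
    Finsupp.sum_fintype _ _ (fun x => by rw [zero_smul]), map_sum]
  refine Finset.sum_congr rfl fun x _ => ?_
  rw [map_smul, smul_eq_mul]
  rfl

/-- **Rank of a quasi-idempotent**: if `a² = C a` in `k[G]` with `C ≠ 0`, then on every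
finite-dimensional representation `M` of the finite group `G`,
`C · dim (a · M) = ∑_g a(g) χ_M(g)` (`C⁻¹ a` acts as an idempotent with range `a · M`, whose trace is
its rank). Fulton–Harris §2.4 (2.32) / the mechanism of Lemma 4.26.
[cite: FultonHarrisGTM129, §2.4 (2.32)] -/
theorem mul_finrank_range_asAlgebraHom_eq_sum [Fintype G] [FiniteDimensional k M]
    (ρ : Representation k G M) (a : MonoidAlgebra k G) {C : k} (hC : C ≠ 0) (ha : a * a = C • a) :
    C * (Module.finrank k (LinearMap.range (ρ.asAlgebraHom a)) : k) =
      ∑ g, a.coeff g * ρ.character g := by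
  set P : M →ₗ[k] M := ρ.asAlgebraHom a with hP
  have hPP : P * P = C • P := by
    rw [hP, ← map_mul, ha, map_smul]
  have he : IsIdempotentElem (C⁻¹ • P) := by
    change (C⁻¹ • P) * (C⁻¹ • P) = C⁻¹ • P
    rw [Algebra.smul_mul_assoc, Algebra.mul_smul_comm, hPP, smul_smul, smul_smul,
      mul_assoc, inv_mul_cancel₀ hC, mul_one]
  have hrange : LinearMap.range (C⁻¹ • P) = LinearMap.range P :=
    LinearMap.range_smul _ _ (inv_ne_zero hC)
  have htr : LinearMap.trace k M (C⁻¹ • P) = (Module.finrank k (LinearMap.range P) : k) := by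
    rw [(LinearMap.IsIdempotentElem.isProj_range _ he).trace, hrange]
  rw [← trace_asAlgebraHom_eq_sum, ← hP, ← htr, map_smul, smul_eq_mul, ← mul_assoc,
    mul_inv_cancel₀ hC, one_mul]

/-- The group algebra acts on a sub-representation by restriction of its action on the ambient
module (coercion lemma). [folklore] -/
private theorem coe_subrepresentation_asAlgebraHom' (ρ : Representation k G M) (X : Submodule k M)
    (hX : ∀ g, X ≤ X.comap (ρ g)) (a : MonoidAlgebra k G) (x : X) :
    (((ρ.subrepresentation X hX).asAlgebraHom a x : X) : M) = ρ.asAlgebraHom a (x : M) := by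
  induction a using MonoidAlgebra.induction_on with
  | hM g =>
    rw [Representation.asAlgebraHom_of, Representation.asAlgebraHom_of,
      Representation.subrepresentation_apply, LinearMap.coe_restrict_apply]
  | hadd a b ha hb =>
    rw [map_add, map_add, LinearMap.add_apply, LinearMap.add_apply, Submodule.coe_add, ha, hb]
  | hsmul r a ha =>
    rw [map_smul, map_smul, LinearMap.smul_apply, LinearMap.smul_apply, Submodule.coe_smul, ha]

/-! ### §2 `a · M ∩ X = a · X` for a stable subspace -/

/-- **`a · M ∩ X = a · X`** for a quasi-idempotent `a² = C a`, `C ≠ 0`, of `k[G]` and a `G`-stable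
subspace `X` of a representation `M` (the right side computed in the sub-representation `X` and
pushed into `M`): `⊇` is clear, `⊆` because `a v = C v` on `a · M`, so `v = a (C⁻¹ v)` with
`C⁻¹ v ∈ X`. (t08's `range_youngSymmetrizer_inf_eq_map` is the case `a = c_μ`.)
[cite: FultonHarrisGTM129, Lemma 4.26] -/
theorem range_asAlgebraHom_inf_eq_map_of_mul_self (ρ : Representation k G M) (X : Submodule k M)
    (hX : ∀ g, X ≤ X.comap (ρ g)) (a : MonoidAlgebra k G) {C : k} (hC : C ≠ 0)
    (ha : a * a = C • a) :
    LinearMap.range (ρ.asAlgebraHom a) ⊓ X =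
      (LinearMap.range ((ρ.subrepresentation X hX).asAlgebraHom a)).map X.subtype := by
  set A := ρ.asAlgebraHom a with hA
  have hAA : ∀ y, A (A y) = C • A y := fun y => by
    rw [hA, ← Module.End.mul_apply, ← map_mul, ha, map_smul, LinearMap.smul_apply]
  ext y
  constructor
  · rintro ⟨⟨u, rfl⟩, hyX⟩
    refine ⟨(ρ.subrepresentation X hX).asAlgebraHom a (C⁻¹ • ⟨A u, hyX⟩),
      LinearMap.mem_range_self _ _, ?_⟩
    rw [Submodule.coe_subtype, coe_subrepresentation_asAlgebraHom', Submodule.coe_smul, map_smul]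
    change C⁻¹ • A (A u) = A u
    rw [hAA, smul_smul, inv_mul_cancel₀ hC, one_smul]
  · rintro ⟨z, ⟨x, rfl⟩, rfl⟩
    refine ⟨?_, ?_⟩
    · rw [Submodule.coe_subtype, coe_subrepresentation_asAlgebraHom']
      exact LinearMap.mem_range_self _ _
    · exact Submodule.coe_mem _

/-- Dimension form: `dim (a · X) = dim (a · M ∩ X)`. [cite: FultonHarrisGTM129, Lemma 4.26] -/
theorem finrank_range_asAlgebraHom_subrepresentation_of_mul_self (ρ : Representation k G M)
    (X : Submodule k M) (hX : ∀ g, X ≤ X.comap (ρ g)) (a : MonoidAlgebra k G) {C : k} (hC : C ≠ 0)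
    (ha : a * a = C • a) :
    Module.finrank k (LinearMap.range ((ρ.subrepresentation X hX).asAlgebraHom a)) =
      Module.finrank k ↥(LinearMap.range (ρ.asAlgebraHom a) ⊓ X) := by
  rw [range_asAlgebraHom_inf_eq_map_of_mul_self ρ X hX a hC ha, Submodule.finrank_map_subtype_eq]

end Rank

/-! ### §3 The blockwise Young symmetrizers commute: `c_{μ•}² = (∏_i n_{μ^i}) c_{μ•}` -/

section MultiYoung

variable (k : Type*) [Field k] {d : ℕ} {n : Fin d → ℕ}

/-- Permutations of different blocks commute in `𝔖_{n₁+⋯+n_d}` (they are the images of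
`Pi.mulSingle`s at different indices under one homomorphism): the Young subgroup
`𝔖_{n₁} × ⋯ × 𝔖_{n_d} ⊆ 𝔖_n` is a direct product (Fulton–Harris §4.3, before (4.41); IK §3,
TeX L353–357, "embed `G ↪ G × ⋯ × G`"). [cite: FultonHarrisGTM129, §4.3 (4.41)] -/
theorem IK2020.commute_blockPermHom {i j : Fin d} (hij : i ≠ j) (x : Equiv.Perm (Fin (n i)))
    (y : Equiv.Perm (Fin (n j))) :
    Commute (IK2020.blockPermHom n i x) (IK2020.blockPermHom n j y) := by
  exact Commute.map (Pi.mulSingle_commute (f := fun j => Equiv.Perm (Fin (n j))) hij x y)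
    ((Equiv.permCongrHom (finSigmaFinEquiv (n := n))).toMonoidHom.comp
      (Equiv.Perm.sigmaCongrRightHom fun j => Fin (n j)))

/-- Group-algebra elements pushed forward along homomorphisms with commuting images commute.
[folklore] -/
private theorem commute_mapDomain_of_commute {G H₁ H₂ : Type*} [Group G] [Group H₁] [Group H₂]
    (f₁ : H₁ →* G) (f₂ : H₂ →* G) (hf : ∀ x y, Commute (f₁ x) (f₂ y))
    (a : MonoidAlgebra k H₁) (b : MonoidAlgebra k H₂) :
    Commute (MonoidAlgebra.mapDomainAlgHom k k f₁ a) (MonoidAlgebra.mapDomainAlgHom k k f₂ b) := by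
  induction a using MonoidAlgebra.induction_on with
  | hM x =>
    induction b using MonoidAlgebra.induction_on with
    | hM y =>
      rw [MonoidAlgebra.mapDomainAlgHom_apply, MonoidAlgebra.mapDomainAlgHom_apply,
        MonoidAlgebra.of_apply, MonoidAlgebra.of_apply, MonoidAlgebra.mapDomain_single,
        MonoidAlgebra.mapDomain_single]
      change MonoidAlgebra.single (f₁ x) (1 : k) * MonoidAlgebra.single (f₂ y) 1 =
        MonoidAlgebra.single (f₂ y) 1 * MonoidAlgebra.single (f₁ x) 1
      rw [MonoidAlgebra.single_mul_single, MonoidAlgebra.single_mul_single, (hf x y).eq]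
    | hadd b c hb hc => rw [map_add]; exact hb.add_right hc
    | hsmul r b hb => rw [map_smul]; exact hb.smul_right r
  | hadd a c ha hc => rw [map_add]; exact ha.add_left hc
  | hsmul r a ha => rw [map_smul]; exact ha.smul_left r

/-- Squares of products of pairwise commuting quasi-idempotents. [folklore] -/
private theorem prod_ofFn_mul_self {A : Type*} [Ring A] [Algebra k A] :
    ∀ {d : ℕ} (g : Fin d → A) (c : Fin d → k), (∀ i, g i * g i = c i • g i) →
      (∀ i j, i ≠ j → Commute (g i) (g j)) →
        (List.ofFn g).prod * (List.ofFn g).prod = (∏ i, c i) • (List.ofFn g).prod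
  | 0, g, c, _, _ => by simp
  | d + 1, g, c, hsq, hcomm => by
    rw [List.ofFn_succ, List.prod_cons, Fin.prod_univ_succ]
    have ih := prod_ofFn_mul_self (fun i : Fin d => g i.succ) (fun i => c i.succ)
      (fun i => hsq i.succ) (fun i j hij => hcomm _ _ fun h => hij (Fin.succ_injective _ h))
    set L := (List.ofFn fun i : Fin d => g i.succ).prod with hL
    have hcL : Commute (g 0) L :=
      Commute.list_prod_right _ _ (List.forall_mem_ofFn_iff.mpr fun j =>
        hcomm _ _ (Fin.succ_ne_zero j).symm)
    calc g 0 * L * (g 0 * L) = (g 0 * g 0) * (L * L) := by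
          rw [mul_assoc, ← mul_assoc L (g 0) L, ← hcL.eq, mul_assoc, mul_assoc]
      _ = (c 0 • g 0) * ((∏ i : Fin d, c i.succ) • L) := by rw [hsq, ih]
      _ = (c 0 * ∏ i : Fin d, c i.succ) • (g 0 * L) := by
          rw [smul_mul_assoc, mul_smul_comm, smul_smul]

/-- **`c_{μ•}² = (∏_i n_{μ^i}) · c_{μ•}`**: the product of the blockwise Young symmetrizers is a
quasi-idempotent with constant the product of the constants `n_{μ^i} = (c_{μ^i}²)(1)`
(`youngSymmetrizer_sq`; the blocks commute, `IK2020.commute_blockPermHom`).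
[cite: FultonHarrisGTM129, Lemma 4.26] -/
theorem IK2020.multiYoungSymmetrizer_mul_self [CharZero k] (μ : (i : Fin d) → Nat.Partition (n i)) :
    IK2020.multiYoungSymmetrizer k μ * IK2020.multiYoungSymmetrizer k μ =
      (∏ i, (youngSymmetrizer k (μ i) * youngSymmetrizer k (μ i)).coeff 1) •
        IK2020.multiYoungSymmetrizer k μ := by
  unfold IK2020.multiYoungSymmetrizer
  refine prod_ofFn_mul_self k _ _ (fun i => ?_) (fun i j hij => ?_)
  · rw [← map_mul, youngSymmetrizer_sq k (μ i), map_smul]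
    rw [← youngSymmetrizer_sq k (μ i)]
  · exact commute_mapDomain_of_commute k _ _ (fun x y => IK2020.commute_blockPermHom hij x y) _ _

/-- The constant `∏_i n_{μ^i}` is nonzero in characteristic zero
(`coeff_sq_youngSymmetrizer_ne_zero`). [cite: FultonHarrisGTM129, Lemma 4.26] -/
theorem IK2020.prod_coeff_sq_youngSymmetrizer_ne_zero [CharZero k]
    (μ : (i : Fin d) → Nat.Partition (n i)) :
    (∏ i, (youngSymmetrizer k (μ i) * youngSymmetrizer k (μ i)).coeff 1) ≠ 0 :=
  Finset.prod_ne_zero_iff.mpr fun i _ => coeff_sq_youngSymmetrizer_ne_zero k (μ i)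

end MultiYoung

/-! ### §4 `c^λ_{μ•} = dim (c_{μ•} · HW_λ((k^N)^{⊗n}))` -/

section Transport

variable (k : Type*) [Field k] {N : ℕ}

/-- Highest-weight vectors along the coordinate isomorphism: `v ∈ (k^N)^{⊗n}` is a highest-weight
vector of weight `χ` iff `wordCoord v` is one in the word model (`wordCoord_glTensorRep`).
[folklore] -/
private theorem mem_highestWeightSpace_glTensorRep_iff_wordCoord {n : ℕ} (χ : Weight (Fin N))
    (v : TensorPower k n (Fin N → k)) :
    v ∈ highestWeightSpace (glTensorRep (Fin N) k n) χ ↔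
      wordCoord k N n v ∈ highestWeightSpace (wordRep k N n) χ := by
  rw [mem_highestWeightSpace_iff, mem_highestWeightSpace_iff]
  refine forall₂_congr fun g _ => ?_
  rw [← wordCoord_glTensorRep, ← map_smul, (wordCoord k N n).injective.eq_iff]

variable {d : ℕ} {n : Fin d → ℕ}

/-- A vector of `{μ¹} ⊗ ⋯ ⊗ {μ^d} ⊆ (k^N)^{⊗n}` is a highest-weight vector of weight `χ` for the
restricted action iff the underlying tensor is. [folklore] -/
private theorem mem_highestWeightSpace_multiWeylRep_iff (μ : (i : Fin d) → Nat.Partition (n i))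
    (χ : Weight (Fin N)) (v : IK2020.multiWeylModule k N μ) :
    v ∈ highestWeightSpace (V := IK2020.multiWeylModule k N μ) (IK2020.multiWeylRep k N μ) χ ↔
      (v : TensorPower k (∑ j, n j) (Fin N → k)) ∈
        highestWeightSpace (glTensorRep (Fin N) k (∑ j, n j)) χ := by
  rw [mem_highestWeightSpace_iff, mem_highestWeightSpace_iff]
  refine forall₂_congr fun g _ => ?_
  rw [Subtype.ext_iff, Submodule.coe_smul]
  exact Iff.rfl

/-- **`wordCoord (HW_χ({μ¹} ⊗ ⋯ ⊗ {μ^d})) = c_{μ•} · (words) ∩ HW_χ(words)`**: the highest-weight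
space of weight `χ` of `multiWeylRep`, pushed into `(k^N)^{⊗n}` and through the coordinate
isomorphism, is the intersection of the image `c_{μ•} ·` (functions of words) with the
highest-weight space of the word model (t08's `wordCoord_asAlgebraHom_permTensorRep`,
`wordCoord_glTensorRep`). [cite: FultonHarrisGTM129, §6.1 Lemma 6.22] -/
theorem IK2020.map_wordCoord_highestWeightSpace_multiWeylRep
    (μ : (i : Fin d) → Nat.Partition (n i)) (χ : Weight (Fin N)) :
    ((highestWeightSpace (V := IK2020.multiWeylModule k N μ) (IK2020.multiWeylRep k N μ) χ).map
        (IK2020.multiWeylModule k N μ).subtype).map (wordCoord k N (∑ j, n j)).toLinearMap =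
      LinearMap.range ((wordPermRep k N (∑ j, n j)).asAlgebraHom
          (IK2020.multiYoungSymmetrizer k μ)) ⊓
        highestWeightSpace (wordRep k N (∑ j, n j)) χ := by
  set c := IK2020.multiYoungSymmetrizer k μ with hc
  set A := (wordPermRep k N (∑ j, n j)).asAlgebraHom c with hA
  ext y
  constructor
  · rintro ⟨t, ⟨v, hv, rfl⟩, rfl⟩
    obtain ⟨u, hu⟩ := (LinearMap.mem_range.mp v.2 :
      (v : TensorPower k (∑ j, n j) (Fin N → k)) ∈
        LinearMap.range ((permTensorRep k (Fin N → k) (∑ j, n j)).asAlgebraHom c))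
    refine ⟨⟨wordCoord k N _ u, ?_⟩, ?_⟩
    · change A (wordCoord k N _ u) = wordCoord k N _ (v : TensorPower k (∑ j, n j) (Fin N → k))
      rw [← hu, wordCoord_asAlgebraHom_permTensorRep]
    · exact (mem_highestWeightSpace_glTensorRep_iff_wordCoord k χ _).mp
        ((mem_highestWeightSpace_multiWeylRep_iff k μ χ v).mp (SetLike.mem_coe.mp hv))
  · rintro ⟨⟨z, rfl⟩, hyH⟩
    set t := (wordCoord k N (∑ j, n j)).symm (A z) with ht
    have htW : t ∈ IK2020.multiWeylModule k N μ := by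
      refine ⟨(wordCoord k N _).symm z, ?_⟩
      apply (wordCoord k N (∑ j, n j)).injective
      rw [wordCoord_asAlgebraHom_permTensorRep, LinearEquiv.apply_symm_apply, ht,
        LinearEquiv.apply_symm_apply]
    have hty : wordCoord k N _ t = A z := by rw [ht, LinearEquiv.apply_symm_apply]
    refine ⟨t, ⟨⟨t, htW⟩, ?_, rfl⟩, hty⟩
    rw [SetLike.mem_coe, mem_highestWeightSpace_multiWeylRep_iff, Submodule.coe_mk,
      mem_highestWeightSpace_glTensorRep_iff_wordCoord, hty]
    exact hyH

/-- **`c^λ_{μ¹…μ^d} = dim (c_{μ•} · HW_λ((k^N)^{⊗n}))`** (characteristic zero): IK's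
multi-Littlewood–Richardson coefficient, defined as the `λ`-highest-weight multiplicity of
`{μ¹} ⊗ ⋯ ⊗ {μ^d} = c_{μ•} · (k^N)^{⊗n}`, is the rank of `c_{μ•}` acting on the `𝔖_n`-representation
`HW_λ((k^N)^{⊗n})` (`hwPermRep`; `≅ [λ]` when `ℓ(λ) ≤ N`) — Weyl's construction in coordinates and
`c_{μ•} · M ∩ X = c_{μ•} · X` (§2 with §3). [cite: IkenmeyerKandasamy2019, §3]
[cite: FultonHarrisGTM129, §6.1 Lemma 6.22] -/
theorem IK2020.multiLRCoeff_eq_finrank_range [CharZero k] (μ : (i : Fin d) → Nat.Partition (n i))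
    {s : ℕ} (lam : Nat.Partition s) :
    IK2020.multiLRCoeff k N μ lam =
      Module.finrank k (LinearMap.range ((hwPermRep k (D := ∑ j, n j)
        (Weight.ofPartition N lam)).asAlgebraHom (IK2020.multiYoungSymmetrizer k μ))) := by
  rw [hwPermRep, finrank_range_asAlgebraHom_subrepresentation_of_mul_self _ _ _ _
      (IK2020.prod_coeff_sq_youngSymmetrizer_ne_zero k μ) (IK2020.multiYoungSymmetrizer_mul_self k μ),
    ← IK2020.map_wordCoord_highestWeightSpace_multiWeylRep, LinearEquiv.finrank_map_eq,
    Submodule.finrank_map_subtype_eq]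
  rfl

/-! ### §5 `(∏_i n_{μ^i}) · c^λ_{μ•} = ∑_g c_{μ•}(g) χ^λ(g)` -/

/-- **The multi-Littlewood–Richardson coefficient as a trace on `[λ]`**: for `ℓ(λ) ≤ N`
(characteristic zero), `(∏_i n_{μ^i}) · c^λ_{μ¹…μ^d} = ∑_{g ∈ 𝔖_n} c_{μ•}(g) χ^λ(g)`, where
`c_{μ•} = c_{μ¹} ⋯ c_{μ^d}` is the product of the blockwise Young symmetrizers and
`n_μ = (c_μ²)(1) = |μ|!/f^μ` (§1 for the quasi-idempotent `c_{μ•}`, §3, §4, and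
`character_hwPermRep`: the `𝔖_n`-character of `HW_λ((k^N)^{⊗n})` is `χ^λ`). This is the
symmetric-group side of `c^λ_{μ•} = ⟨Res χ^λ, ⊠_i χ^{μ^i}⟩_{𝔖_{n₁}×⋯×𝔖_{n_d}}` (Fulton–Harris
(4.41)–(4.43), Ex. 4.44) before the blockwise conjugation average.
[cite: FultonHarrisGTM129, §4.3 (4.41)–(4.43)] [cite: IkenmeyerKandasamy2019, §3] -/
theorem IK2020.prod_mul_multiLRCoeff_eq_sum [CharZero k] (μ : (i : Fin d) → Nat.Partition (n i))
    (lam : Nat.Partition (∑ j, n j)) (hlam : lam.parts.card ≤ N) :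
    (∏ i, (youngSymmetrizer k (μ i) * youngSymmetrizer k (μ i)).coeff 1) *
        (IK2020.multiLRCoeff k N μ lam : k) =
      ∑ g : Equiv.Perm (Fin (∑ j, n j)),
        (IK2020.multiYoungSymmetrizer k μ).coeff g * spechtCharacter k lam g := by
  rw [IK2020.multiLRCoeff_eq_finrank_range, ← character_hwPermRep k lam hlam]
  exact mul_finrank_range_asAlgebraHom_eq_sum _ _ (IK2020.prod_coeff_sq_youngSymmetrizer_ne_zero k μ)
    (IK2020.multiYoungSymmetrizer_mul_self k μ)

end Transport

end Literature.Computability.AlgebraicComplexity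

end
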